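import Summits.QuantumFields.YangMills.Theorems.SwapVirialDeficitBlowUpGnomonicLeaderGroupDist
import HarnessLib

/-!
# The leader group distance to the base point — EVERY hub (in particular the apex hub `1`)

Sub-problem `SwapVirialDeficit`, crux ⟨stmt-QuantumFields-24197⟩ `SwapGluedStiffness`, skeleton ➎, stub `stub_core_tip`, socket (hCore).
✓`leaderGroupDist_le` is stated at the hubs `hubAt δ 1`; the K7g group step of w2 g61's ✓`abs_log_det_tip_mod_rot_group` runs at the APEX hub
`((1:ℝ):ℍ)`, which is not of that form.  Here the same estimate for an ARBITRARY hub `a ≠ 0` (the hub entry `C₃ = ν(axisPoint a)` is letter-free and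
cancels; the slaved entry `C₁ = ν̄ X̂ ν Ẑ` is handled by ✓`norm_conj_mul_sub_le`):
* ★ `leaderGroupDist_le_hub` — for every `μ : Fin 4`,
  `‖su2Quat C_μ(a; ((x₀,0,0),(y₀,0,0)),(0,F′)) − su2Quat C_μ(a; ((x,y),(z,F)))‖ ≤ √(2|x⊥|²/(1+|x|²)) + √(2|z|²/(1+|z|²)) + √(2|y⊥|²/(1+|y|²))`;
(the apex specialisation `a = 1` is w2 g61's ✓`leaderGroupDist_le_apex`, landed concurrently; this general-hub form serves tilted / permuted hubs).

HONEST LABEL: letter bookkeeping only; (hCore), `stub_core_tip`, ⟨24197⟩, ⟨24194⟩ remain OPEN; nothing here proves the Yang–Mills mass gap.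
-/

noncomputable section

open MeasureTheory Quaternion
open scoped BigOperators Quaternion RealInnerProductSpace
open Literature.MathematicalPhysics.QuantumFieldTheory hiding SU2
open Literature.MathematicalPhysics.QuantumLattice
open Literature.Analysis.Calculus (radialUnit radialUnit_def norm_radialUnit)

namespace Summit.QuantumFields.YangMills.Theorems.SwapVirialDeficit.BlowUpRing

open Summit.QuantumFields.YangMills.Theorems.FemtoTransferGap
open Summit.QuantumFields.YangMills.Theorems.FemtoTransferGap.TT
open Summit.QuantumFields.YangMills.Theorems.VirialFluxGap.RingDeficit
open Summit.QuantumFields.YangMills.Theorems.SwapVirialDeficit.SwapRing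
open Summit.QuantumFields.YangMills.Theorems.SwapTwistDeficit.ToronLog (axisPoint)

variable {L : ℕ}

/-- ★ **THE LEADER GROUP DISTANCE TO THE BASE POINT, EVERY HUB `a ≠ 0`**: for every `μ : Fin 4`,
`‖su2Quat C_μ(((x₀,0,0),(y₀,0,0)),(0,F′)) − su2Quat C_μ(((x,y),(z,F)))‖ ≤ d_x + d_z + d_y`, `d_x = √(2(x₁²+x₂²)/(1+|x|²))`, `d_y` likewise,
`d_z = √(2|z|²/(1+|z|²))`. [folklore] -/
theorem leaderGroupDist_le_hub {a : ℍ} (ha : a ≠ 0) (ε : GnoSign L) (x y z : Fin 3 → ℝ) (F F' : Fol L → Fin 3 → ℝ) (μ : Fin 4) :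
    ‖su2Quat ((blowUpPoint (L := L) 1 (gnomonicPoint a ε ((((![x 0, 0, 0] : Fin 3 → ℝ), (![y 0, 0, 0] : Fin 3 → ℝ)), ((0 : Fin 3 → ℝ), F')) : GnoCoord L))).1 μ) -
        su2Quat ((blowUpPoint (L := L) 1 (gnomonicPoint a ε (((x, y), (z, F)) : GnoCoord L))).1 μ)‖ ≤
      Real.sqrt (2 * ((x 1) ^ 2 + (x 2) ^ 2) / (1 + ((x 0) ^ 2 + (x 1) ^ 2 + (x 2) ^ 2))) +
        Real.sqrt (2 * ((z 0) ^ 2 + (z 1) ^ 2 + (z 2) ^ 2) / (1 + ((z 0) ^ 2 + (z 1) ^ 2 + (z 2) ^ 2))) +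
        Real.sqrt (2 * ((y 1) ^ 2 + (y 2) ^ 2) / (1 + ((y 0) ^ 2 + (y 1) ^ 2 + (y 2) ^ 2))) := by
  set ηb : GnoCoord L := ((((![x 0, 0, 0] : Fin 3 → ℝ), (![y 0, 0, 0] : Fin 3 → ℝ)), ((0 : Fin 3 → ℝ), F')) : GnoCoord L) with hηb
  set η : GnoCoord L := (((x, y), (z, F)) : GnoCoord L) with hη
  have b0 := su2Quat_gnoLeader_zero (L := L) a ε ηb
  have b1 := su2Quat_gnoLeader_one (L := L) ha ε ηb
  have b2 := su2Quat_gnoLeader_two (L := L) a ε ηb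
  have b3 := su2Quat_gnoLeader_three (L := L) ha ε ηb
  have e0 := su2Quat_gnoLeader_zero (L := L) a ε η
  have e1 := su2Quat_gnoLeader_one (L := L) ha ε η
  have e2 := su2Quat_gnoLeader_two (L := L) a ε η
  have e3 := su2Quat_gnoLeader_three (L := L) ha ε η
  have hb11 : ηb.1.1 = (![x 0, 0, 0] : Fin 3 → ℝ) := rfl
  have hb12 : ηb.1.2 = (![y 0, 0, 0] : Fin 3 → ℝ) := rfl
  have hb21 : ηb.2.1 = (0 : Fin 3 → ℝ) := rfl
  have h11 : η.1.1 = x := rfl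
  have h12 : η.1.2 = y := rfl
  have h21 : η.2.1 = z := rfl
  rw [hb11] at b0 b1
  rw [hb21] at b1
  rw [hb12] at b2
  rw [h11] at e0 e1
  rw [h21] at e1
  rw [h12] at e2
  -- the three elementary distances
  have dX : ‖radialUnit (gnoLetter ε.1.1 (![x 0, 0, 0] : Fin 3 → ℝ)) - radialUnit (gnoLetter ε.1.1 x)‖ ≤
      Real.sqrt (2 * ((x 1) ^ 2 + (x 2) ^ 2) / (1 + ((x 0) ^ 2 + (x 1) ^ 2 + (x 2) ^ 2))) := by
    rw [norm_sub_rev]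
    exact (Real.le_sqrt (norm_nonneg _) (by positivity)).2 (norm_radialUnit_gnoLetter_sub_axial_sq_le ε.1.1 x)
  have dY : ‖radialUnit (gnoLetter ε.1.2 (![y 0, 0, 0] : Fin 3 → ℝ)) - radialUnit (gnoLetter ε.1.2 y)‖ ≤
      Real.sqrt (2 * ((y 1) ^ 2 + (y 2) ^ 2) / (1 + ((y 0) ^ 2 + (y 1) ^ 2 + (y 2) ^ 2))) := by
    rw [norm_sub_rev]
    exact (Real.le_sqrt (norm_nonneg _) (by positivity)).2 (norm_radialUnit_gnoLetter_sub_axial_sq_le ε.1.2 y)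
  have dZ : ‖radialUnit (gnoLetter ε.2.1 (0 : Fin 3 → ℝ)) - radialUnit (gnoLetter ε.2.1 z)‖ ≤
      Real.sqrt (2 * ((z 0) ^ 2 + (z 1) ^ 2 + (z 2) ^ 2) / (1 + ((z 0) ^ 2 + (z 1) ^ 2 + (z 2) ^ 2))) := by
    rw [norm_sub_rev]
    exact (Real.le_sqrt (norm_nonneg _) (by positivity)).2 (norm_radialUnit_gnoLetter_sub_zero_sq_le ε.2.1 z)
  have s0 : 0 ≤ Real.sqrt (2 * ((x 1) ^ 2 + (x 2) ^ 2) / (1 + ((x 0) ^ 2 + (x 1) ^ 2 + (x 2) ^ 2))) := Real.sqrt_nonneg _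
  have s1 : 0 ≤ Real.sqrt (2 * ((z 0) ^ 2 + (z 1) ^ 2 + (z 2) ^ 2) / (1 + ((z 0) ^ 2 + (z 1) ^ 2 + (z 2) ^ 2))) := Real.sqrt_nonneg _
  have s2 : 0 ≤ Real.sqrt (2 * ((y 1) ^ 2 + (y 2) ^ 2) / (1 + ((y 0) ^ 2 + (y 1) ^ 2 + (y 2) ^ 2))) := Real.sqrt_nonneg _
  fin_cases μ
  · simp only [Fin.zero_eta] at *
    rw [b0, e0]
    linarith [dX]
  · simp only [Fin.mk_one] at *
    rw [b1, e1]
    have hap : axisPoint a ≠ 0 := fun h => by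
      have e := bfar_norm_axisPoint_sq a
      rw [h, norm_zero] at e
      exact ha (norm_eq_zero.1 (by nlinarith [norm_nonneg a]))
    have hna : ‖radialUnit (axisPoint a)‖ = 1 := norm_radialUnit hap
    have hsa : ‖star (radialUnit (axisPoint a))‖ = 1 := by rw [Quaternion.norm_star, hna]
    have hX : ‖radialUnit (gnoLetter ε.1.1 x)‖ = 1 := norm_radialUnit (gnoLetter_ne_zero _ _)
    have hZ0 : ‖radialUnit (gnoLetter ε.2.1 (0 : Fin 3 → ℝ))‖ = 1 := norm_radialUnit (gnoLetter_ne_zero _ _)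
    have h := norm_conj_mul_sub_le (X := radialUnit (gnoLetter ε.1.1 (![x 0, 0, 0] : Fin 3 → ℝ))) (X' := radialUnit (gnoLetter ε.1.1 x))
      (Z := radialUnit (gnoLetter ε.2.1 (0 : Fin 3 → ℝ))) (Z' := radialUnit (gnoLetter ε.2.1 z)) hsa hna hX hZ0
    linarith [dX, dZ]
  · simp only [Fin.reduceFinMk] at *
    rw [b2, e2]
    linarith [dY]
  · simp only [Fin.reduceFinMk] at *
    rw [b3, e3, sub_self, norm_zero]
    positivity

end Summit.QuantumFields.YangMills.Theorems.SwapVirialDeficit.BlowUpRing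

end
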